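import Mathlib
import HarnessLib
import Literature.NumberTheory.LFunctions.ZetaScrew
import Literature.NumberTheory.LFunctions.ZetaScrewLogTwoPos
import Literature.NumberTheory.LFunctions.ZetaScrewThm42Proofs
import Literature.NumberTheory.LFunctions.ZetaScrewThm41Proofs

/-!
# DBR column, rung B-P(P1): anti-persistence of the zeta screw line on the WHOLE prime-free wall —
# `Ψ(2s) < 2Ψ(s)` for every `0 < s ≤ (log 2)/2`

RH-FREE calculus inequality (LINE 1 of the label discipline): a theorem about the explicit archimedean–Lerch
closed form of Suzuki's screw function `Ψ = Literature.NumberTheory.LFunctions.zetaScrew` on the wall `[0, log 2]`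
(Suzuki2023 (1.1); no prime contributes there). NOT worded as, and not, progress toward RH; «`Ψ(2s) < 2Ψ(s)` for
all `s > 0`» stays a conjecture from data (neither proved RH-free nor an RH-consequence).

Context (HOME `run/shared/lean/pub/rh-dbr/DATA/hm/HM.md` §4 (P1-c), seat rh-dbr-eng-2, 2026-08-26). On a
lattice of mesh `s` inside `{log n}` the increments of Suzuki's screw line (`‖x(t) − x(u)‖² = 2Ψ(t − u)`)
have the Toeplitz Gram matrix `c_j(s) = Ψ((j+1)s) − 2Ψ(js) + Ψ((j−1)s)`; the first reflection coefficient of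
its Levinson (= discrete de Branges–Kreĭn, Suzuki arXiv:1308.0228 Thm 1.1) recursion is
`κ₁(s) = −c₁(s)/c₀(s) = 1 − Ψ(2s)/(2Ψ(s))`. The companion file `DbrLatticeAntipersistence` makes
`κ₁ > 0` a kernel theorem at the 55 meshes `s = log(p/q)`, `1 ≤ q < p ≤ 11`. THIS file proves it on the
whole continuum of prime-free meshes:

* `zetaScrew_two_mul_lt_two_mul` — **`Ψ(2s) < 2Ψ(s)` for all `0 < s ≤ (log 2)/2`**; corollaries `kappaOne_pos`
  (`0 < 1 − Ψ(2s)/(2Ψ(s))`, using the tree's `Ψ > 0` on `(0, log 2]`) and `lagOne_increment_cov_neg` (`c₁(s) < 0`).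

Method [folklore]. For `0 ≤ s`, `2s ≤ log 2` the closed form (1.1) (tree: `Suzuki2023Thm42.zetaScrew_eq_cosh_tsum`,
extended here to the closed wall) gives the TWO-POINT GAP
`D(s) := 2Ψ(s) − Ψ(2s) = Σ_{k ≥ 0} (1 − e^{−λ'_k s})²/λ'_k² − 4(e^{s/2} − 1)²`, `λ'_k = 2k + 5/2`
(`two_mul_zetaScrew_sub_eq_gap`): the linear term of (1.1) cancels, `2(1−x) − (1−x²) = (1−x)²` termwise,
and the `k = 0` Lerch term `4(1 − e^{−s/2})²` cancels the `e^{−s/2}` half of `16(cosh(s/2)−1) − 8(cosh s − 1)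
= −4(e^{s/2}−1)² − 4(e^{−s/2}−1)²`. Secant monotonicity of `exp` (`convexOn_exp.secant_mono`:
`(eˣ−1)/x` increases, `(1−e^{−x})/x` decreases) gives the SCALING LAW `D(s) ≥ (s/s₀)²·D(s₀)` for
`0 < s ≤ s₀` (`gap_scaling`), so everything reduces to ONE rational certificate at `s₀ = (log 2)/2`,
where `e^{s₀/2} = r := 2^{1/4}` and `e^{−λ'_k s₀} = r⁻¹·2^{−(k+1)}`: twenty terms of the series give
`D(s₀) ≥ 0.1555 − 0.1432 > 0` (`gap_half_log_two_pos`; numerically `D(s₀) = 0.02430`).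

SHARPNESS (companion file `DbrWallAntipersistenceSharp`): `D(2 log(11/9)) < 0` — past the wall the
archimedean part alone would turn persistent by mesh `0.40`; the actual `Ψ` stays anti-persistent there because
the prime `2` enters `Ψ(2s)` at `2s = log 2`. Nothing here bears on the truth of RH.

References: M. Suzuki, J. Lond. Math. Soc. (2) 108 (2023) = arXiv:2206.03682, (1.1), proof of Thm 4.1 [Suzuki2023];
M. Suzuki, J. Anal. Math. 136 (2018) = arXiv:1308.0228, Thm 1.1 [Suzuki2013]. -/

set_option linter.dupNamespace false

noncomputable section

open scoped BigOperators
open Set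
namespace Summit.RiemannHypothesis.RiemannHypothesis.Theorems.DbrWall

open Literature.NumberTheory.LFunctions

/-! ### The closed form of `Ψ` on the CLOSED wall `|t| ≤ log 2` -/

/-- The prime sum of (1.1) vanishes on the closed wall `|t| ≤ log 2` (at `|t| = log 2` the only prime power
`n = 2 ≤ e^{|t|}` enters with the factor `|t| − log 2 = 0`). [cite: Suzuki2023, proof of Thm 4.1] -/
theorem zetaScrewPrimeSum_eq_zero_of_abs_le_log_two {t : ℝ} (ht : |t| ≤ Real.log 2) :
    zetaScrewPrimeSum t = 0 := by
  rcases ht.lt_or_eq with h | h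
  · exact zetaScrewPrimeSum_eq_zero_of_abs_lt_log_two h
  · have habs : zetaScrewPrimeSum t = zetaScrewPrimeSum |t| := by
      simp only [zetaScrewPrimeSum, abs_abs]
    rw [habs, h, zetaScrewPrimeSum_log_two]

/-- (1.1) on the closed wall with the Hurwitz–Lerch term summed termwise:
`Ψ(v) = 8(cosh(v/2) − 1) − (A/2)|v| + Σ_k (1 − e^{−λ_k|v|})/λ_k²`, `λ_k = 2k + 1/2`,
`A = γ₀ + π/2 + 3 log 2 + log π`, for `|v| ≤ log 2` (the tree's `Suzuki2023Thm42.zetaScrew_eq_cosh_tsum`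
is the open wall `|v| < log 2`; same computation). [cite: Suzuki2023, (1.1) and proof of Thm 4.1] -/
theorem zetaScrew_eq_cosh_tsum_of_abs_le {v : ℝ} (hv : |v| ≤ Real.log 2) :
    zetaScrew v = 8 * (Real.cosh (v / 2) - 1)
      - (Real.eulerMascheroniConstant + Real.pi / 2 + 3 * Real.log 2 + Real.log Real.pi) / 2
          * |v|
      + ∑' k : ℕ, (1 - Real.exp (-((2 * k + 1 / 2) * |v|))) / (2 * (k : ℝ) + 1 / 2) ^ 2 := by
  rw [zetaScrew_eq, zetaScrewPrimeSum_eq_zero_of_abs_le_log_two hv, sub_zero, hurwitzLerchQuarter]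
  have hcosh : Real.exp (|v| / 2) + Real.exp (-(|v| / 2)) - 2 = 2 * (Real.cosh (v / 2) - 1) := by
    rw [← Real.cosh_abs (v / 2), Real.cosh_eq, abs_div, abs_two]
    ring
  rw [hcosh, ← tsum_mul_left, ← (summable_one_div_nat_add_quarter_sq).tsum_sub
    ((summable_hurwitzLerchQuarter v).mul_left _), ← tsum_mul_left]
  have hterm : ∀ k : ℕ, (1 / 4 : ℝ) * (1 / ((k : ℝ) + 1 / 4) ^ 2
      - Real.exp (-(|v| / 2)) * (Real.exp (-(2 * |v| * k)) / ((k : ℝ) + 1 / 4) ^ 2))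
      = (1 - Real.exp (-((2 * k + 1 / 2) * |v|))) / (2 * (k : ℝ) + 1 / 2) ^ 2 := by
    intro k
    have hk : (2 * (k : ℝ) + 1 / 2) ^ 2 = 4 * ((k : ℝ) + 1 / 4) ^ 2 := by ring
    have hk0 : ((k : ℝ) + 1 / 4) ^ 2 ≠ 0 := by positivity
    rw [hk, show Real.exp (-((2 * k + 1 / 2) * |v|))
        = Real.exp (-(|v| / 2)) * Real.exp (-(2 * |v| * k)) by rw [← Real.exp_add]; ring_nf]
    field_simp
  rw [tsum_congr hterm]
  ring

/-- The same for `0 ≤ t ≤ log 2`, without absolute values. [cite: Suzuki2023, (1.1) and proof of Thm 4.1] -/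
theorem zetaScrew_eq_cosh_tsum_of_le {t : ℝ} (ht0 : 0 ≤ t) (ht : t ≤ Real.log 2) :
    zetaScrew t = 8 * (Real.cosh (t / 2) - 1)
      - (Real.eulerMascheroniConstant + Real.pi / 2 + 3 * Real.log 2 + Real.log Real.pi) / 2 * t
      + ∑' k : ℕ, (1 - Real.exp (-((2 * k + 1 / 2) * t))) / (2 * (k : ℝ) + 1 / 2) ^ 2 := by
  have habs : |t| = t := abs_of_nonneg ht0
  have h := zetaScrew_eq_cosh_tsum_of_abs_le (v := t) (by rwa [habs])
  rwa [habs] at h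

/-! ### The two-point gap `D(s)` -/

/-- `Σ_k λ'_k⁻²` converges. [folklore] -/
theorem summable_one_div_lam_sq : Summable fun k : ℕ => 1 / (2 * (k : ℝ) + 5 / 2) ^ 2 := by
  have h := (summable_nat_add_iff 1).2 summable_one_div_nat_add_quarter_sq
  have h' : Summable fun k : ℕ => (1 / 4 : ℝ) * (1 / (((k + 1 : ℕ) : ℝ) + 1 / 4) ^ 2) := h.mul_left _
  refine h'.congr fun k => ?_
  have hk : (2 * (k : ℝ) + 5 / 2) ^ 2 = 4 * (((k + 1 : ℕ) : ℝ) + 1 / 4) ^ 2 := by push_cast; ring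
  rw [hk]
  have h0 : (((k + 1 : ℕ) : ℝ) + 1 / 4) ^ 2 ≠ 0 := by positivity
  field_simp

/-- For `s ≥ 0` the gap series converges (termwise `0 ≤ (1 − e^{−λ'_k s})² ≤ 1`). [folklore] -/
theorem summable_gap_terms {s : ℝ} (hs : 0 ≤ s) :
    Summable fun k : ℕ => (1 - Real.exp (-((2 * (k : ℝ) + 5 / 2) * s))) ^ 2 / (2 * (k : ℝ) + 5 / 2) ^ 2 := by
  refine summable_one_div_lam_sq.of_nonneg_of_le (fun k => by positivity) fun k => ?_
  apply div_le_div_of_nonneg_right _ (by positivity)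
  have h1 : Real.exp (-((2 * (k : ℝ) + 5 / 2) * s)) ≤ 1 := by
    rw [Real.exp_le_one_iff, neg_nonpos]; exact mul_nonneg (by positivity) hs
  have h0 : 0 ≤ Real.exp (-((2 * (k : ℝ) + 5 / 2) * s)) := (Real.exp_pos _).le
  nlinarith

/-- For `s ≥ 0` the wall series `Σ_k (1 − e^{−λ_k s})/λ_k²` converges. [folklore] -/
theorem summable_wall_terms {s : ℝ} (hs : 0 ≤ s) :
    Summable fun k : ℕ => (1 - Real.exp (-((2 * k + 1 / 2) * s))) / (2 * (k : ℝ) + 1 / 2) ^ 2 := by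
  have hq : Summable fun k : ℕ => (1 / 4 : ℝ) * (1 / ((k : ℝ) + 1 / 4) ^ 2) :=
    summable_one_div_nat_add_quarter_sq.mul_left _
  refine hq.of_nonneg_of_le (fun k => ?_) fun k => ?_
  · apply div_nonneg _ (by positivity)
    rw [sub_nonneg, Real.exp_le_one_iff, neg_nonpos]; positivity
  · have hk : (2 * (k : ℝ) + 1 / 2) ^ 2 = 4 * ((k : ℝ) + 1 / 4) ^ 2 := by ring
    have h1 : 0 ≤ Real.exp (-((2 * k + 1 / 2) * s)) := (Real.exp_pos _).le
    calc (1 - Real.exp (-((2 * k + 1 / 2) * s))) / (2 * (k : ℝ) + 1 / 2) ^ 2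
        ≤ 1 / (2 * (k : ℝ) + 1 / 2) ^ 2 :=
          div_le_div_of_nonneg_right (by linarith) (by positivity)
      _ = (1 / 4 : ℝ) * (1 / ((k : ℝ) + 1 / 4) ^ 2) := by
          rw [hk]
          have h0 : ((k : ℝ) + 1 / 4) ^ 2 ≠ 0 := by positivity
          field_simp

/-- **Two-point identity on the wall**: for `0 ≤ s`, `2s ≤ log 2`,
`2Ψ(s) − Ψ(2s) = Σ_{k≥0} (1 − e^{−λ'_k s})²/λ'_k² − 4(e^{s/2} − 1)² = D(s)` (the linear term of (1.1) and
the `k = 0` Lerch term cancel exactly). [folklore] -/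
theorem two_mul_zetaScrew_sub_eq_gap {s : ℝ} (hs0 : 0 ≤ s) (hs : 2 * s ≤ Real.log 2) :
    2 * zetaScrew s - zetaScrew (2 * s) =
      (∑' k : ℕ, (1 - Real.exp (-((2 * (k : ℝ) + 5 / 2) * s))) ^ 2 / (2 * (k : ℝ) + 5 / 2) ^ 2)
      - 4 * (Real.exp (s / 2) - 1) ^ 2 := by
  have hs1 : s ≤ Real.log 2 := by linarith
  rw [zetaScrew_eq_cosh_tsum_of_le hs0 hs1, zetaScrew_eq_cosh_tsum_of_le (by linarith) hs]
  -- the archimedean quantities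
  set a : ℝ := Real.exp (s / 2) with ha
  have ha0 : 0 < a := Real.exp_pos _
  have hcosh1 : Real.cosh (s / 2) = (a + a⁻¹) / 2 := by
    rw [Real.cosh_eq, Real.exp_neg]
  have hcosh2 : Real.cosh (2 * s / 2) = (a * a + a⁻¹ * a⁻¹) / 2 := by
    rw [show 2 * s / 2 = s / 2 + s / 2 by ring, Real.cosh_eq, neg_add, Real.exp_add, Real.exp_add,
      Real.exp_neg]
  -- the series
  have hS1 := summable_wall_terms hs0
  have hS2 := summable_wall_terms (by linarith : (0 : ℝ) ≤ 2 * s)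
  have hsq : ∀ k : ℕ, 2 * ((1 - Real.exp (-((2 * k + 1 / 2) * s))) / (2 * (k : ℝ) + 1 / 2) ^ 2)
      - (1 - Real.exp (-((2 * k + 1 / 2) * (2 * s)))) / (2 * (k : ℝ) + 1 / 2) ^ 2
      = (1 - Real.exp (-((2 * k + 1 / 2) * s))) ^ 2 / (2 * (k : ℝ) + 1 / 2) ^ 2 := by
    intro k
    have he : Real.exp (-((2 * k + 1 / 2) * (2 * s))) = Real.exp (-((2 * k + 1 / 2) * s)) ^ 2 := by
      rw [sq, ← Real.exp_add]; ring_nf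
    rw [he]
    have h0 : (2 * (k : ℝ) + 1 / 2) ^ 2 ≠ 0 := by positivity
    field_simp
    ring
  have hT : 2 * (∑' k : ℕ, (1 - Real.exp (-((2 * k + 1 / 2) * s))) / (2 * (k : ℝ) + 1 / 2) ^ 2)
      - (∑' k : ℕ, (1 - Real.exp (-((2 * k + 1 / 2) * (2 * s)))) / (2 * (k : ℝ) + 1 / 2) ^ 2)
      = ∑' k : ℕ, (1 - Real.exp (-((2 * k + 1 / 2) * s))) ^ 2 / (2 * (k : ℝ) + 1 / 2) ^ 2 := by
    rw [← tsum_mul_left, ← (hS1.mul_left 2).tsum_sub hS2]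
    exact tsum_congr hsq
  -- split off `k = 0`
  have hS3 : Summable fun k : ℕ =>
      (1 - Real.exp (-((2 * k + 1 / 2) * s))) ^ 2 / (2 * (k : ℝ) + 1 / 2) ^ 2 := by
    have := (hS1.mul_left 2).sub hS2
    refine this.congr fun k => ?_
    rw [← hsq k]
  have hsplit := hS3.tsum_eq_zero_add
  have hshift : ∀ k : ℕ, (1 - Real.exp (-((2 * ((k + 1 : ℕ) : ℝ) + 1 / 2) * s))) ^ 2
      / (2 * ((k + 1 : ℕ) : ℝ) + 1 / 2) ^ 2
      = (1 - Real.exp (-((2 * (k : ℝ) + 5 / 2) * s))) ^ 2 / (2 * (k : ℝ) + 5 / 2) ^ 2 := by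
    intro k
    have : (2 * ((k + 1 : ℕ) : ℝ) + 1 / 2) = (2 * (k : ℝ) + 5 / 2) := by push_cast; ring
    rw [this]
  simp only [hshift, Nat.cast_zero, mul_zero, zero_add] at hsplit
  have h0 : (1 - Real.exp (-(1 / 2 * s))) ^ 2 / (1 / 2 : ℝ) ^ 2 = 4 * (1 - a⁻¹) ^ 2 := by
    rw [show -(1 / 2 * s) = -(s / 2) by ring, Real.exp_neg]
    ring
  rw [h0] at hsplit
  rw [hcosh1, hcosh2]
  linear_combination hT + hsplit

/-! ### The scaling law `D(s) ≥ (s/s₀)²·D(s₀)` -/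

/-- Secant monotonicity of `exp` at `0`, increasing side: for `0 < x ≤ y`,
`eˣ − 1 ≤ (x/y)(eʸ − 1)`. [folklore] -/
theorem exp_sub_one_le_scaled {x y : ℝ} (hx : 0 < x) (hxy : x ≤ y) :
    Real.exp x - 1 ≤ x / y * (Real.exp y - 1) := by
  have hy : 0 < y := hx.trans_le hxy
  have h := convexOn_exp.secant_mono (a := 0) (x := x) (y := y) (mem_univ _) (mem_univ _)
    (mem_univ _) hx.ne' hy.ne' hxy
  simp only [Real.exp_zero, sub_zero] at h
  rw [div_le_div_iff₀ hx hy] at h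
  rw [div_mul_eq_mul_div, le_div_iff₀ hy]
  linarith

/-- Secant monotonicity of `exp` at `0`, decreasing side: for `c > 0`, `0 < x ≤ y`,
`(x/y)(1 − e^{−cy}) ≤ 1 − e^{−cx}`. [folklore] -/
theorem scaled_one_sub_exp_le {c x y : ℝ} (hc : 0 < c) (hx : 0 < x) (hxy : x ≤ y) :
    x / y * (1 - Real.exp (-(c * y))) ≤ 1 - Real.exp (-(c * x)) := by
  have hy : 0 < y := hx.trans_le hxy
  have hcx : 0 < c * x := mul_pos hc hx
  have hcy : 0 < c * y := mul_pos hc hy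
  have h := convexOn_exp.secant_mono (a := 0) (x := -(c * y)) (y := -(c * x)) (mem_univ _)
    (mem_univ _) (mem_univ _) (by linarith) (by linarith) (by nlinarith)
  simp only [Real.exp_zero, sub_zero] at h
  have e1 : (Real.exp (-(c * y)) - 1) / -(c * y) = (1 - Real.exp (-(c * y))) / (c * y) := by ring
  have e2 : (Real.exp (-(c * x)) - 1) / -(c * x) = (1 - Real.exp (-(c * x))) / (c * x) := by ring
  rw [e1, e2, div_le_div_iff₀ hcy hcx] at h
  rw [div_mul_eq_mul_div, div_le_iff₀ hy]
  nlinarith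

/-- **Scaling law**: `(s/s')²·D(s') ≤ D(s)` for `0 < s ≤ s'` (each series term scales at least like
`(s/s')²`, the subtracted term at most like `(s/s')²`). [folklore] -/
theorem gap_scaling {s s' : ℝ} (hs : 0 < s) (hss : s ≤ s') :
    (s / s') ^ 2 * ((∑' k : ℕ, (1 - Real.exp (-((2 * (k : ℝ) + 5 / 2) * s'))) ^ 2 / (2 * (k : ℝ) + 5 / 2) ^ 2)
      - 4 * (Real.exp (s' / 2) - 1) ^ 2)
      ≤ (∑' k : ℕ, (1 - Real.exp (-((2 * (k : ℝ) + 5 / 2) * s))) ^ 2 / (2 * (k : ℝ) + 5 / 2) ^ 2)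
      - 4 * (Real.exp (s / 2) - 1) ^ 2 := by
  have hs' : 0 < s' := hs.trans_le hss
  have hq0 : 0 ≤ s / s' := by positivity
  -- the subtracted term
  have hA0 : 0 ≤ Real.exp (s / 2) - 1 := by
    rw [sub_nonneg]; exact Real.one_le_exp (by positivity)
  have hA : Real.exp (s / 2) - 1 ≤ s / s' * (Real.exp (s' / 2) - 1) := by
    have h := exp_sub_one_le_scaled (x := s / 2) (y := s' / 2) (by positivity) (by linarith)
    rwa [show s / 2 / (s' / 2) = s / s' by field_simp] at h
  have hA2 : (Real.exp (s / 2) - 1) ^ 2 ≤ (s / s') ^ 2 * (Real.exp (s' / 2) - 1) ^ 2 := by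
    rw [← mul_pow]; exact pow_le_pow_left₀ hA0 hA 2
  -- the series, termwise
  have hterm : ∀ k : ℕ, (s / s') ^ 2 * ((1 - Real.exp (-((2 * (k : ℝ) + 5 / 2) * s'))) ^ 2 / (2 * (k : ℝ) + 5 / 2) ^ 2)
      ≤ (1 - Real.exp (-((2 * (k : ℝ) + 5 / 2) * s))) ^ 2 / (2 * (k : ℝ) + 5 / 2) ^ 2 := by
    intro k
    have hlk : (0 : ℝ) < 2 * (k : ℝ) + 5 / 2 := by positivity
    have hB := scaled_one_sub_exp_le hlk hs hss
    have hB0 : 0 ≤ s / s' * (1 - Real.exp (-((2 * (k : ℝ) + 5 / 2) * s'))) := by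
      apply mul_nonneg hq0
      rw [sub_nonneg, Real.exp_le_one_iff, neg_nonpos]
      exact mul_nonneg hlk.le hs'.le
    have hB2 := pow_le_pow_left₀ hB0 hB 2
    rw [mul_pow] at hB2
    have hl : 0 < (2 * (k : ℝ) + 5 / 2) ^ 2 := pow_pos hlk 2
    rw [← mul_div_assoc]
    exact div_le_div_of_nonneg_right hB2 hl.le
  have hS' := summable_gap_terms hs'.le
  have hS := summable_gap_terms hs.le
  have hsum : (s / s') ^ 2 * (∑' k : ℕ, (1 - Real.exp (-((2 * (k : ℝ) + 5 / 2) * s'))) ^ 2 / (2 * (k : ℝ) + 5 / 2) ^ 2)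
      ≤ ∑' k : ℕ, (1 - Real.exp (-((2 * (k : ℝ) + 5 / 2) * s))) ^ 2 / (2 * (k : ℝ) + 5 / 2) ^ 2 := by
    rw [← tsum_mul_left]
    exact (hS'.mul_left _).tsum_le_tsum hterm hS
  nlinarith

/-! ### The one rational certificate at `s₀ = (log 2)/2` -/

/-- `r := e^{(log 2)/4} = 2^{1/4}` satisfies `r⁴ = 2`. [folklore] -/
theorem exp_log_two_div_four_pow_four : Real.exp (Real.log 2 / 4) ^ 4 = 2 := by
  rw [← Real.exp_nat_mul, show ((4 : ℕ) : ℝ) * (Real.log 2 / 4) = Real.log 2 by push_cast; ring,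
    Real.exp_log two_pos]

/-- `1.189207 < 2^{1/4} < 1.189208`. [folklore] -/
theorem exp_log_two_div_four_bounds :
    (1.189207 : ℝ) < Real.exp (Real.log 2 / 4) ∧ Real.exp (Real.log 2 / 4) < 1.189208 := by
  set r := Real.exp (Real.log 2 / 4) with hr
  have hr0 : 0 < r := Real.exp_pos _
  have hr4 := exp_log_two_div_four_pow_four
  constructor
  · by_contra h
    push Not at h
    have := pow_le_pow_left₀ hr0.le h 4
    rw [hr4] at this
    norm_num at this
  · by_contra h
    push Not at h
    have := pow_le_pow_left₀ (by norm_num) h 4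
    rw [hr4] at this
    norm_num at this

/-- The gap exponentials at `s₀ = (log 2)/2`: `e^{−λ'_k s₀} = 2^{−(k+1)}·r⁻¹`, `r = 2^{1/4}`. [folklore] -/
theorem exp_neg_lam_mul_half_log_two (k : ℕ) :
    Real.exp (-((2 * (k : ℝ) + 5 / 2) * (Real.log 2 / 2))) = (1 / 2 : ℝ) ^ (k + 1) * (Real.exp (Real.log 2 / 4))⁻¹ := by
  set r := Real.exp (Real.log 2 / 4) with hr
  have hr0 : 0 < r := Real.exp_pos _
  have hr4 := exp_log_two_div_four_pow_four
  have h1 : Real.exp (-((2 * (k : ℝ) + 5 / 2) * (Real.log 2 / 2))) = r⁻¹ ^ (4 * k + 5) := by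
    rw [show (2 * (k : ℝ) + 5 / 2) * (Real.log 2 / 2) = ((4 * k + 5 : ℕ) : ℝ) * (Real.log 2 / 4) by
      push_cast; ring, Real.exp_neg, Real.exp_nat_mul, inv_pow]
  have h2 : r⁻¹ ^ (4 * k + 5) = (r⁻¹ ^ 4) ^ (k + 1) * r⁻¹ := by ring
  have h3 : r⁻¹ ^ 4 = 1 / 2 := by rw [inv_pow, hr4, one_div]
  rw [h1, h2, h3]

/-- **`D((log 2)/2) > 0`**, i.e. `Ψ(log 2) < 2Ψ((log 2)/2)` in certificate form: twenty terms of the series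
(`≥ 0.1555`) against `4(2^{1/4} − 1)² < 0.1432` (numerically `D = 0.16750 − 0.14320 = 0.02430`). [folklore] -/
theorem gap_half_log_two_pos :
    0 < (∑' k : ℕ, (1 - Real.exp (-((2 * (k : ℝ) + 5 / 2) * (Real.log 2 / 2)))) ^ 2 / (2 * (k : ℝ) + 5 / 2) ^ 2)
      - 4 * (Real.exp ((Real.log 2 / 2) / 2) - 1) ^ 2 := by
  set r := Real.exp (Real.log 2 / 4) with hr
  have hr0 : 0 < r := Real.exp_pos _
  obtain ⟨hr_lo, hr_hi⟩ := exp_log_two_div_four_bounds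
  have hrinv : r⁻¹ ≤ 0.8409 := by
    rw [inv_eq_one_div, div_le_iff₀ hr0]; nlinarith
  have hrinv0 : 0 ≤ r⁻¹ := by positivity
  have hs0 : (0 : ℝ) ≤ Real.log 2 / 2 := by positivity
  rw [show Real.log 2 / 2 / 2 = Real.log 2 / 4 by ring]
  simp only [exp_neg_lam_mul_half_log_two]
  -- lower bound of the series by twenty terms with `r⁻¹ ≤ 0.8409`
  have hS : Summable fun k : ℕ =>
      (1 - (1 / 2 : ℝ) ^ (k + 1) * r⁻¹) ^ 2 / (2 * (k : ℝ) + 5 / 2) ^ 2 := by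
    have := summable_gap_terms hs0
    simp only [exp_neg_lam_mul_half_log_two] at this
    exact this
  have hpartial : ∑ k ∈ Finset.range 20, (1 - (1 / 2 : ℝ) ^ (k + 1) * r⁻¹) ^ 2 / (2 * (k : ℝ) + 5 / 2) ^ 2
      ≤ ∑' k : ℕ, (1 - (1 / 2 : ℝ) ^ (k + 1) * r⁻¹) ^ 2 / (2 * (k : ℝ) + 5 / 2) ^ 2 :=
    hS.sum_le_tsum (Finset.range 20) (fun k _ => by positivity)
  have hterm : ∀ k : ℕ, (1 - (1 / 2 : ℝ) ^ (k + 1) * 0.8409) ^ 2 / (2 * (k : ℝ) + 5 / 2) ^ 2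
      ≤ (1 - (1 / 2 : ℝ) ^ (k + 1) * r⁻¹) ^ 2 / (2 * (k : ℝ) + 5 / 2) ^ 2 := by
    intro k
    apply div_le_div_of_nonneg_right _ (by positivity)
    have hq0 : 0 ≤ (1 / 2 : ℝ) ^ (k + 1) := by positivity
    have hq1 : (1 / 2 : ℝ) ^ (k + 1) ≤ 1 := pow_le_one₀ (by norm_num) (by norm_num)
    have hlo : 0 ≤ 1 - (1 / 2 : ℝ) ^ (k + 1) * 0.8409 := by nlinarith
    have hle : 1 - (1 / 2 : ℝ) ^ (k + 1) * 0.8409 ≤ 1 - (1 / 2 : ℝ) ^ (k + 1) * r⁻¹ := by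
      nlinarith [mul_le_mul_of_nonneg_left hrinv hq0]
    exact pow_le_pow_left₀ hlo hle 2
  have hnum : (0.1555 : ℝ) ≤
      ∑ k ∈ Finset.range 20, (1 - (1 / 2 : ℝ) ^ (k + 1) * 0.8409) ^ 2 / (2 * (k : ℝ) + 5 / 2) ^ 2 := by
    simp only [Finset.sum_range_succ, Finset.sum_range_zero]
    norm_num
  have hsum : (0.1555 : ℝ) ≤ ∑' k : ℕ, (1 - (1 / 2 : ℝ) ^ (k + 1) * r⁻¹) ^ 2 / (2 * (k : ℝ) + 5 / 2) ^ 2 :=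
    hnum.trans ((Finset.sum_le_sum fun k _ => hterm k).trans hpartial)
  -- the subtracted term
  have hsub : 4 * (r - 1) ^ 2 < 0.1432 := by nlinarith
  linarith

/-! ### The theorem and its corollaries -/

/-- **Anti-persistence of the zeta screw line on the whole prime-free wall** (RH-FREE calculus
inequality): `Ψ(2s) < 2Ψ(s)` for every `0 < s ≤ (log 2)/2`. [folklore] -/
theorem zetaScrew_two_mul_lt_two_mul {s : ℝ} (hs0 : 0 < s) (hs : s ≤ Real.log 2 / 2) :
    zetaScrew (2 * s) < 2 * zetaScrew s := by
  have hgap := two_mul_zetaScrew_sub_eq_gap hs0.le (by linarith)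
  have hscale := gap_scaling hs0 hs
  have hpos := gap_half_log_two_pos
  have hq : 0 < (s / (Real.log 2 / 2)) ^ 2 := by
    have : 0 < Real.log 2 / 2 := by positivity
    positivity
  nlinarith

/-- The same in the window variable: `Ψ(t) < 2Ψ(t/2)` for every `0 < t ≤ log 2`. [folklore] -/
theorem zetaScrew_lt_two_mul_zetaScrew_half {t : ℝ} (ht0 : 0 < t) (ht : t ≤ Real.log 2) :
    zetaScrew t < 2 * zetaScrew (t / 2) := by
  have h := zetaScrew_two_mul_lt_two_mul (s := t / 2) (by positivity) (by linarith)
  rwa [show 2 * (t / 2) = t by ring] at h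

/-- **`κ₁(s) > 0` on the whole prime-free wall**: `0 < 1 − Ψ(2s)/(2Ψ(s))` for `0 < s ≤ (log 2)/2` — the
first Levinson / Schur–Suzuki reflection coefficient of the screw line sampled at mesh `s` is positive
(unconditionally: `Ψ(s) > 0` there by the tree's `Suzuki2023Thm41.zetaScrew_pos_of_le_log_two`). [folklore] -/
theorem kappaOne_pos {s : ℝ} (hs0 : 0 < s) (hs : s ≤ Real.log 2 / 2) :
    0 < 1 - zetaScrew (2 * s) / (2 * zetaScrew s) := by
  have h := zetaScrew_two_mul_lt_two_mul hs0 hs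
  have hl2 : 0 < Real.log 2 := Real.log_pos one_lt_two
  have hpos : 0 < zetaScrew s := Suzuki2023Thm41.zetaScrew_pos_of_le_log_two hs0 (by linarith)
  have h2 : 0 < 2 * zetaScrew s := by linarith
  rw [sub_pos, div_lt_one h2]
  exact h

/-- **Negative lag-one increment covariance**: the Toeplitz entry
`c₁(s) = Ψ(2s) − 2Ψ(s) + Ψ(0)` of the increment Gram matrix of the mesh-`s` lattice screw line is `< 0`
for `0 < s ≤ (log 2)/2` (with `c₀(s) = 2Ψ(s) > 0`). [folklore] -/
theorem lagOne_increment_cov_neg {s : ℝ} (hs0 : 0 < s) (hs : s ≤ Real.log 2 / 2) :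
    zetaScrew (2 * s) - 2 * zetaScrew s + zetaScrew 0 < 0 := by
  have h := zetaScrew_two_mul_lt_two_mul hs0 hs
  rw [zetaScrew_zero]
  linarith

end Summit.RiemannHypothesis.RiemannHypothesis.Theorems.DbrWall
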